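import Literature.AlgebraicGeometry.Frobenioids.PerfFactorial
import Literature.AlgebraicGeometry.Frobenioids.CategoryTheoreticityFacts
import Literature.AlgebraicGeometry.Frobenioids.DivisorMonoidCategoryTheoreticity
import HarnessLib

/-!
# Frobenioids I, §4: Theorem 4.2 (i) and Corollary 4.11 (ii) as NAMED FACTS over Frobenioids

Mochizuki, *The geometry of Frobenioids I* (2008), Thm. 4.2 p. 77, Cor. 4.11 pp. 91–92
[cite: MochizukiFrdI2008, Cor. 4.11 (ii) p.91]. Companion of `CategoryTheoreticityFacts.lean` (§3): the
standing hypothesis "`C_i → F_{Φ_i}` a Frobenioid" is the cell's `PreFrobenioid.IsFrobenioid` read through the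
adapter `PreFrobenioidData.ofFunctor`; "`Φ_i` perf-factorial" (Def. 2.4 (i)) is bound to the objectwise
`IsPerfFactorial` of `PerfFactorial.lean` (seat abc-iut-L1-t2). [FrdI] Theorem 4.9, Corollary 4.10,
Corollary 4.11 (iii)/(iv) and Corollary 4.12 are deliberately NOT closed into named facts: their printed
objects/hypotheses are the birationalization `C^birat` (Prop. 4.4 (i)) and "rationally standard type"
(Def. 4.5 (iii)), which enter the statement files as the data-only interfaces `BiratData` / `RSParams`; a
universally quantified data-only interface is refutable by junk instances (RQ7 audit F1/F2), so those facts wait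
for THE constructions (rows: `Thm49`, `Cor410`, `Cor411iii`, `Cor411iv`, `Cor412` of
`DivisorMonoidCategoryTheoreticity.lean`). Nothing here is asserted; no statement of the paper is strengthened.
-/

namespace Literature.AlgebraicGeometry.Frobenioids

open CategoryTheory

universe w v v' u u'

namespace FrdI

/-- **[FrdI] Theorem 4.2 (i)** as a named fact, with "`Φ_i` perf-factorial" (Def. 2.4 (i)) the objectwise
`IsPerfFactorial` of `PerfFactorial.lean` (seat abc-iut-L1-t2). [cite: MochizukiFrdI2008, Thm. 4.2 (i) p.77] -/
def Thm42i : Prop :=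
  ∀ {D₁ : Type u} [Category.{v} D₁] {Φ₁ : D₁ᵒᵖ ⥤ CommMonCat.{w}} {C₁ : Type u'} [Category.{v'} C₁]
    {D₂ : Type u} [Category.{v} D₂] {Φ₂ : D₂ᵒᵖ ⥤ CommMonCat.{w}} {C₂ : Type u'} [Category.{v'} C₂]
    (F₁ : C₁ ⥤ ElemFrobenioid Φ₁) (F₂ : C₂ ⥤ ElemFrobenioid Φ₂),
      PreFrobenioid.IsFrobenioid F₁ → PreFrobenioid.IsFrobenioid F₂ →
      (∀ X : D₁, IsPerfFactorial (Φ₁.obj (Opposite.op X))) →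
      (∀ X : D₂, IsPerfFactorial (Φ₂.obj (Opposite.op X))) →
        ∀ Ψ : C₁ ≌ C₂, (PreFrobenioidData.ofFunctor Φ₁ F₁).Thm42i (PreFrobenioidData.ofFunctor Φ₂ F₂) Ψ

/-- **[FrdI] Corollary 4.11 (ii)** (the `1`-unique `Ψ^Base` for Frobenioids of standard type over Div-slim
bases, `Φ_i` perf-factorial = objectwise `IsPerfFactorial`) as a named fact — the most cited item of [FrdI] in
IUT. [cite: MochizukiFrdI2008, Cor. 4.11 (ii) p.91] -/
def Cor411ii : Prop :=
  ∀ {D₁ : Type u} [Category.{v} D₁] {Φ₁ : D₁ᵒᵖ ⥤ CommMonCat.{w}} {C₁ : Type u'} [Category.{v'} C₁]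
    {D₂ : Type u} [Category.{v} D₂] {Φ₂ : D₂ᵒᵖ ⥤ CommMonCat.{w}} {C₂ : Type u'} [Category.{v'} C₂]
    (F₁ : C₁ ⥤ ElemFrobenioid Φ₁) (F₂ : C₂ ⥤ ElemFrobenioid Φ₂),
      PreFrobenioid.IsFrobenioid F₁ → PreFrobenioid.IsFrobenioid F₂ →
      (∀ X : D₁, IsPerfFactorial (Φ₁.obj (Opposite.op X))) →
      (∀ X : D₂, IsPerfFactorial (Φ₂.obj (Opposite.op X))) →
        ∀ Ψ : C₁ ≌ C₂, (PreFrobenioidData.ofFunctor Φ₁ F₁).Cor411ii (PreFrobenioidData.ofFunctor Φ₂ F₂) Ψ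

end FrdI

end Literature.AlgebraicGeometry.Frobenioids
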